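import Mathlib.RingTheory.Polynomial.Hermite.Basic
import Summits.Ventures.HSemireg.WedgeHankelRecurrenceGaussBlockTraceBounds

/-!
# Venture HSemireg — **CALIBRATION AGAINST MATHLIB'S HERMITE POLYNOMIALS**: the probabilists' Hermite polynomials `He_n` (`Polynomial.hermite`, `He_{n+1} = X He_n − He_n'`) satisfy
# `He_{n+1}' = (n+1) He_n` and hence the positive three-term recurrence `He_{n+2} = X He_{n+1} − (n+1) He_n` (`a_n = 0`, `b_n = n`); so the chapter applies: `He_{t+1}` has `t + 1` simple real
# zeros `x_0 < ⋯ < x_t`, symmetric (`x_k = −x_{t−k}`, `Σ x_k = 0`), with `Σ x_k² = t(t+1)` and `|x_k| ≤ √t + √(t+1)` (Gershgorin)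

HONEST FRAMING. Part of the Lean index of the computation cell `pub-hsemireg` (seat p10 gen 45, Sunday typer «UNIFORM-IN-n»).  Mathlib's integer Hermite polynomials mapped to `ℝ[X]`, finite sums
and `Real.sqrt` only; no variety, no cohomology theory, no sheaf, no Ext group and no semiregularity map is constructed here; nothing here says that HC / HC_CM / HC_AV holds; no Literature fact
(unproved `Prop`) is declared or used.  Custodian versions as in `WedgeHankelSiegelIdeal` (1/3).
SOURCES (cited).  G. Szegő, *Orthogonal Polynomials*, §5.5 ((5.5.8) `H_n' = 2n H_{n−1}`, (5.5.10) the recurrence) and Thm 6.31.1 ∕ (6.31.19) (bounds for the largest zero of `H_n`); M. Abramowitz,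
I. A. Stegun, *Handbook of Mathematical Functions*, 22.7.14 and 22.8.8 (probabilists' normalisation `He`); T. S. Chihara, *An Introduction to Orthogonal Polynomials* (1978) Ch. V §2 (B).
PROOF TYPED HERE.  `He_{n+1}' = (n+1) He_n` by induction from Mathlib's `hermite_succ` and the derivative rules; the recurrence follows; N279 (zeros), N340 (symmetry), N298 (second Newton sum
`Σ x_k² = 2 Σ_{j≤t} b_j = t(t+1)`), N329 (Gershgorin with `c_j = √b_j`, row bound `√t + √(t+1)`).
DEDUP DISCLOSURE (`rg -n 'Polynomial.hermite|hermite_three|hermite_zeros' Summits Literature`, 2026-09-03): the tree's «Hermite» files concern Hermite's root-counting forms, not the Hermite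
polynomials; Mathlib has `Polynomial.hermite` with coefficients and the Gaussian-derivative formula but (as far as `rg` in `Mathlib/RingTheory/Polynomial/Hermite` shows) neither the three-term
recurrence nor the reality of the zeros.  The 6 names below: 0 hits tree-wide.

WHAT IS IN THE TREE.  Mathlib `Polynomial.hermite_succ`, `hermite_zero`, `hermite_one`; N279 `recurrence_zeros_interlace`; N340 `symmetric_recurrence_zeros_symm`; N298 `sum_recurrence_zeros_sq`;
N329 `zeros_le_gershgorin`, `gershgorin_le_zeros`.
THIS FILE (namespace `Summit.Ventures.HSemireg.Wedge.HankelOuter` continued; CHAINED on N358 (import only) + Mathlib `RingTheory.Polynomial.Hermite.Basic`; 0 definitions):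
* §1124 **`hermite_derivative_succ`** (`He_{n+1}' = (n+1) He_n` in `ℤ[X]`), **`hermite_three_term`** (`He_{n+2} = X He_{n+1} − (n+1) He_n`), `hermite_real_recurrence` ∕ `hermite_eq_recurrence` (the mapped family solves, and is the only solution of, the
  chapter's recurrence with `a = 0`, `b_{n+1} = n + 1`), `two_mul_sum_range_succ_cast` (`2 Σ_{i≤m} (i+1) = (m+1)(m+2)`), **`hermite_zeros`** (`t + 1` increasing real zeros of `He_{t+1}` with
  `He_{t+1} = ∏ (X − x_k)`, `x_k = −x_{t−k}`, `Σ x_k = 0`, `Σ x_k² = t(t+1)`, `|x_k| ≤ √t + √(t+1)`).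
CAVEATS.  Probabilists' normalisation (`He`, weight `e^{−x²∕2}`); the physicists' `H_n(x) = 2^{n∕2} He_n(x√2)` is not treated.  Nothing Ext-side.  New names only.
-/

open Module Polynomial
open scoped Matrix Polynomial

namespace Summit.Ventures.HSemireg.Wedge.HankelOuter

/-! ## §1124. The Hermite recurrence -/

/-- **`He_{n+1}' = (n + 1) · He_n`** for Mathlib's (probabilists') Hermite polynomials. [Szegő (5.5.8); Abramowitz–Stegun 22.8.8; this file, §1124] -/
theorem hermite_derivative_succ (n : ℕ) : derivative (Polynomial.hermite (n + 1)) = C ((n : ℤ) + 1) * Polynomial.hermite n := by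
  induction n with
  | zero => rw [Polynomial.hermite_one, Polynomial.hermite_zero, derivative_X, Nat.cast_zero, zero_add, C_1, one_mul]
  | succ n ih =>
    rw [Polynomial.hermite_succ (n + 1), derivative_sub, derivative_mul, derivative_X, one_mul, ih, derivative_mul, derivative_C, zero_mul, zero_add,
      Polynomial.hermite_succ n]
    have e : C (((n + 1 : ℕ) : ℤ) + 1) = C ((n : ℤ) + 1) + (1 : ℤ[X]) := by rw [← C_1, ← C_add]; push_cast; ring_nf
    rw [e]
    ring

/-- **THE THREE-TERM RECURRENCE `He_{n+2} = X · He_{n+1} − (n + 1) · He_n`.** [Szegő (5.5.10); Abramowitz–Stegun 22.7.14; this file, §1124] -/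
theorem hermite_three_term (n : ℕ) : Polynomial.hermite (n + 2) = Polynomial.X * Polynomial.hermite (n + 1) - C ((n : ℤ) + 1) * Polynomial.hermite n := by
  rw [Polynomial.hermite_succ (n + 1), hermite_derivative_succ]

/-- **The real Hermite family solves the chapter's recurrence with `a_n = 0`, `b_{n+1} = n + 1`.** [this file, §1124] -/
theorem hermite_real_recurrence :
    (Polynomial.hermite 0).map (Int.castRingHom ℝ) = 1 ∧ (Polynomial.hermite 1).map (Int.castRingHom ℝ) = Polynomial.X - C (0 : ℝ) ∧
      ∀ n, (Polynomial.hermite (n + 2)).map (Int.castRingHom ℝ) =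
        (Polynomial.X - C (0 : ℝ)) * (Polynomial.hermite (n + 1)).map (Int.castRingHom ℝ) - C ((n : ℝ) + 1) * (Polynomial.hermite n).map (Int.castRingHom ℝ) := by
  refine ⟨by rw [Polynomial.hermite_zero, Polynomial.map_C, map_one, C_1], by rw [Polynomial.hermite_one, Polynomial.map_X, C_0, sub_zero], fun n => ?_⟩
  rw [hermite_three_term, Polynomial.map_sub, Polynomial.map_mul, Polynomial.map_mul, Polynomial.map_X, Polynomial.map_C, C_0, sub_zero]
  congr 2
  simp

/-- **Any recurrence with `a = 0` and `b_{n+1} = n + 1` is the real Hermite family.** [this file, §1124] -/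
theorem hermite_eq_recurrence {q : ℕ → ℝ[X]} {a b : ℕ → ℝ} (hq0 : q 0 = 1) (hq1 : q 1 = Polynomial.X - C (a 0))
    (hrec : ∀ n, q (n + 2) = (Polynomial.X - C (a (n + 1))) * q (n + 1) - C (b (n + 1)) * q n) (ha : ∀ n, a n = 0) (hb : ∀ n, b (n + 1) = (n : ℝ) + 1) :
    ∀ n, q n = (Polynomial.hermite n).map (Int.castRingHom ℝ) := by
  obtain ⟨h0, h1, hr⟩ := hermite_real_recurrence
  have key : ∀ n, q n = (Polynomial.hermite n).map (Int.castRingHom ℝ) ∧ q (n + 1) = (Polynomial.hermite (n + 1)).map (Int.castRingHom ℝ) := by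
    intro n
    induction n with
    | zero => exact ⟨by rw [hq0, h0], by rw [hq1, h1, ha]⟩
    | succ n ih =>
      refine ⟨ih.2, ?_⟩
      rw [show n + 1 + 1 = n + 2 by ring, hrec, hr, ih.1, ih.2, ha, hb]
  exact fun n => (key n).1

/-- `2 Σ_{i≤m} (i + 1) = (m+1)(m+2)` in `ℝ`. [bookkeeping; this file, §1124] -/
theorem two_mul_sum_range_succ_cast (m : ℕ) : 2 * ∑ i ∈ Finset.range (m + 1), ((i : ℝ) + 1) = ((m : ℝ) + 1) * ((m : ℝ) + 2) := by
  induction m with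
  | zero => norm_num
  | succ m ih =>
    rw [Finset.sum_range_succ, mul_add, ih]
    push_cast
    ring

/-- **THE ZEROS OF `He_{t+1}`: `t + 1` simple real zeros `x_0 < ⋯ < x_t` with `He_{t+1} = ∏ (X − x_k)`, symmetric about `0`, `Σ x_k = 0`, `Σ x_k² = t(t+1)`, and `|x_k| ≤ √t + √(t+1)`.**
[Szegő §6.31; Chihara V §2; this file, §1124] -/
theorem hermite_zeros (t : ℕ) : ∃ x : Fin (t + 1) → ℝ, StrictMono x ∧ (Polynomial.hermite (t + 1)).map (Int.castRingHom ℝ) = ∏ k, (Polynomial.X - C (x k)) ∧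
    (∀ k, x k = -x (Fin.rev k)) ∧ ∑ k, x k = 0 ∧ ∑ k, x k ^ 2 = (t : ℝ) * ((t : ℝ) + 1) ∧ ∀ k, |x k| ≤ Real.sqrt t + Real.sqrt ((t : ℝ) + 1) := by
  -- the chapter's hypotheses for `q_n = He_n`, `a = 0`, `b_j = max(j, 1)`
  obtain ⟨b, hbdef⟩ : ∃ b : ℕ → ℝ, b = fun j => ((max j 1 : ℕ) : ℝ) := ⟨_, rfl⟩
  obtain ⟨h0, h1, hr⟩ := hermite_real_recurrence
  have hbsucc : ∀ n, b (n + 1) = (n : ℝ) + 1 := fun n => by rw [hbdef]; simp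
  have hrec : ∀ n, (Polynomial.hermite (n + 2)).map (Int.castRingHom ℝ) =
      (Polynomial.X - C (0 : ℝ)) * (Polynomial.hermite (n + 1)).map (Int.castRingHom ℝ) - C (b (n + 1)) * (Polynomial.hermite n).map (Int.castRingHom ℝ) := fun n => by
    rw [hbsucc]; exact hr n
  have hb : ∀ j, 0 < b j := fun j => by
    rw [hbdef]
    have h : 0 < max j 1 := lt_of_lt_of_le Nat.one_pos (le_max_right _ _)
    show (0 : ℝ) < ((max j 1 : ℕ) : ℝ)
    exact_mod_cast h
  have hble : ∀ j, b j ≤ max (j : ℝ) 1 := fun j => by rw [hbdef]; push_cast; exact le_rfl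
  -- zeros, symmetry, Newton sums
  obtain ⟨x, -, hx, -, hxq, -, -⟩ := recurrence_zeros_interlace (q := fun n => (Polynomial.hermite n).map (Int.castRingHom ℝ)) (a := fun _ => (0 : ℝ)) h0 h1 hrec hb t
  obtain ⟨hsymm, hsum⟩ := symmetric_recurrence_zeros_symm (q := fun n => (Polynomial.hermite n).map (Int.castRingHom ℝ)) (a := fun _ => (0 : ℝ)) h0 h1 hrec (fun _ => rfl) hx hxq
  refine ⟨x, hx, hxq, hsymm, hsum, ?_, fun k => ?_⟩
  · rcases t with _ | m
    · have h00 : x 0 = 0 := by have := hsymm 0; rw [show Fin.rev (0 : Fin 1) = 0 from rfl] at this; linarith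
      rw [Finset.sum_eq_zero (fun k _ => by rw [Fin.eq_zero k, h00, zero_pow two_ne_zero]), Nat.cast_zero, zero_mul]
    · rw [sum_recurrence_zeros_sq (q := fun n => (Polynomial.hermite n).map (Int.castRingHom ℝ)) (a := fun _ => (0 : ℝ)) h0 h1 hrec hxq]
      simp only [zero_pow two_ne_zero, Finset.sum_const_zero, zero_add]
      rw [Finset.sum_congr rfl fun i _ => hbsucc i, two_mul_sum_range_succ_cast m]
      push_cast; ring
  · -- Gershgorin with `c_j = √b_j`
    rcases Nat.eq_zero_or_pos t with ht | ht
    · subst ht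
      have h00 : x 0 = 0 := by have := hsymm 0; rw [show Fin.rev (0 : Fin 1) = 0 from rfl] at this; linarith
      rw [Fin.eq_zero k, h00, abs_zero]; positivity
    · have hc : ∀ j, 0 < Real.sqrt (b j) := fun j => Real.sqrt_pos.2 (hb j)
      have hbc : ∀ j, b j ≤ Real.sqrt (b j) ^ 2 := fun j => by rw [Real.sq_sqrt (hb j).le]
      have hrow : ∀ n, n ≤ t → Real.sqrt (b n) + Real.sqrt (b (n + 1)) ≤ Real.sqrt t + Real.sqrt ((t : ℝ) + 1) := fun n hn => by
        refine add_le_add (Real.sqrt_le_sqrt ((hble n).trans ?_)) (Real.sqrt_le_sqrt ?_)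
        · exact max_le (by exact_mod_cast hn) (by exact_mod_cast ht)
        · rw [hbsucc]; exact_mod_cast Nat.succ_le_succ hn
      have hup := zeros_le_gershgorin (q := fun n => (Polynomial.hermite n).map (Int.castRingHom ℝ)) (a := fun _ => (0 : ℝ)) h0 h1 hrec hb hc hbc
        (M := Real.sqrt t + Real.sqrt ((t : ℝ) + 1)) (fun n hn => by rw [zero_add]; exact hrow n hn) hx hxq k
      have hlow := gershgorin_le_zeros (q := fun n => (Polynomial.hermite n).map (Int.castRingHom ℝ)) (a := fun _ => (0 : ℝ)) h0 h1 hrec hb hc hbc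
        (m := -(Real.sqrt t + Real.sqrt ((t : ℝ) + 1))) (fun n hn => by rw [zero_sub]; linarith [hrow n hn]) hx hxq k
      exact abs_le.2 ⟨hlow, hup⟩

end Summit.Ventures.HSemireg.Wedge.HankelOuter
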